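import Mathlib
import Literature.NumberTheory.LFunctions.Zhang2022.Section10Concl1321Rel
import Literature.NumberTheory.LFunctions.Zhang2022.AppendixALemma83RelHolds
import HarnessLib

/-!
# Zhang (2022) §10: `Z22:§10.u045` — "`α⁻¹S_j(𝐚₁₃,𝐚₂₁) = d₄ⱼ𝔞 + o(1)`" (`Typed.Sec10B.Concl1321 c′`)
# HOLDS OUTRIGHT for every `c′ ≥ 0`

Topic `Literature/NumberTheory/LFunctions/Zhang2022` (Landau–Siegel audit tree; verdict-neutral).
Y. Zhang, *Discrete mean estimates and the Landau–Siegel zero*, arXiv:2211.02515v1 (2022)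
[Zhang2022LandauSiegel], §10 p. 59 (tex L3004) — **an unrefereed manuscript under adjudication;
this file composes kernel theorems about its typed §10 / §8 / App. A steps and asserts nothing
about its Theorems 1–2 or about Landau–Siegel zeros.** ZHANG-L discharge lane (WP10, seat
zl-w10-p4).

The leaf `hC1321` of `Skeleton.theorem1_of_leaves_v19/v20/v21` is now UNCONDITIONAL: the relative
Lemma 8.4 `Skeleton.Lemma84Rel c′` is a tree theorem for every `c′` (`Skeleton.lemma84Rel_holds`,
from the App. A closers `Typed.AppendixA1.stepA_u007_analytic_holds` / `stepA_u007_read_holds`,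
`AppendixALemma83RelHolds`), so `Typed.Sec10B.concl1321_of_lemma84Rel` (`Section10Concl1321Rel`)
applies with no hypothesis beyond `0 ≤ c′` (the side condition of Lemma 10.1, `Skeleton.lemma101_holds`).

## References

* Y. Zhang, arXiv:2211.02515v1 (2022), §10 pp. 58–59; §8 Lemma 8.4; App. A p. 101.
  [cite: Zhang2022LandauSiegel, §10 p. 59]
-/

noncomputable section

namespace Literature.NumberTheory.LFunctions.Zhang2022.Typed.Sec10B

open Literature.NumberTheory.LFunctions.Zhang2022

/-- **`Z22:§10.u045` HOLDS** [Z22 p.59, tex L3004]: for every `c′ ≥ 0`,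
"`α⁻¹S_j(𝐚₁₃,𝐚₂₁) = d₄ⱼ𝔞 + o(1)`" — `Typed.Sec10B.Concl1321 c′`, the leaf `hC1321` of the whole-DAG
theorem, with NO manuscript claim as hypothesis: `concl1321_of_lemma84Rel` at
`Skeleton.lemma84Rel_holds`. [cite: Zhang2022LandauSiegel, §10 p. 59] -/
theorem concl1321_holds {c' : ℝ} (hc' : 0 ≤ c') : Concl1321 c' :=
  concl1321_of_lemma84Rel hc' (Skeleton.lemma84Rel_holds c')

/-- The same in the `∀ c′ ≥ 0` closer shape. [cite: Zhang2022LandauSiegel, §10 p. 59] -/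
theorem concl1321_holds_all : ∀ c' : ℝ, 0 ≤ c' → Concl1321 c' :=
  fun _ hc' => concl1321_holds hc'

end Literature.NumberTheory.LFunctions.Zhang2022.Typed.Sec10B
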